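import Mathlib
import HarnessLib
import Literature.Analysis.FluidPDE.ParasiticSlabFlow
import Summits.NavierStokesRegularity.NavierStokesRegularity.Theses.LocalPressureProfileDoor
import Summits.NavierStokesRegularity.NavierStokesRegularity.Theorems.PoloidalWindowDoorPoloidalWindowRigidityWindow
import Summits.NavierStokesRegularity.NavierStokesRegularity.Theorems.LocalPressureProfileDoorMonotonePressureProfileRigiditySmallSliceBudget

/-!
# Route `LocalPressureProfileDoor`, crux K2⁺ `MonotonePressureProfileRigidity` (stmt-NavierStokesRegularity-20180),
# line `birth`: the L stub `stub_smallSliceOfMonotonePressure` — a door-class profile with shift-monotone similarity pressure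
# has θ-small vorticity slices at every similarity radius

Cell ns-regularity-ideate, seat ns-pressure-K2-p1 (LEAD on the crux; registered stub of the skeleton `Lines/birth.lean`,
sha 86b6bcf2…, signature VERBATIM; lands `--supports stmt-NavierStokesRegularity-20180`).

**Statement (the stub).**  Let `v` be a profile of the door class — Type I in time, space–time Type-I decay, continuous on the open
backward slab, unit-viscosity Oseen–Duhamel identity between negative times, divergence-free slices — whose similarity Riesz pressure
`P(t,y) = (−t) Q[v(t)](√(−t) y)` is shift-monotone: `P(e^{−σ}t, y) ≤ P(t, y)` for `t < 0`, `σ ∈ [0,1]`, all `y`.  Then for every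
`R > 0`, `θ > 0` there is `t̄ < 0` with `∫_{B(2R√(−t̄))} ‖curl v(t̄)‖² ≤ θ²/(4√(−t̄))` (Pineau–Vicol's normalisation (9.17)).

**Proof** (the line's mechanism, with the weight realised by a TREE THEOREM).  The door class lies in the Type-I ancient mild class
(`isTypeIAncientMild_of_class` — the Oseen–Duhamel identity `hmild` is consumed HERE; the refuter's certificate
`…Negative.stub_smallSliceOfMonotonePressure_false_without_mild`, p518176, shows it must be).  Helper 1 (`…SmallSliceKernel`) gives
the adapted backward kernel `G` of `∂ₜ + v·∇ − Δ` with pole AT THE APEX and two-sided Gaussian bounds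
(`linearTypeIDriftKernel`, crux `AdaptedKernelExists`): in Leray variables this is the card's eternal adjoint weight with floor and
tightness UNIFORM in `s` — the why-might-fail of the item, settled by the tree.  Helper 4c (`…SmallSliceBudget.dissipation_budget`:
head field, frozen pressure slices, Dini form of FTC-2) gives `∫_{t₁}^{t₂} (−t)H(t) dt ≤ M` for all `−1 < t₁ ≤ t₂ < 0`,
`H(t) = ∫‖curl v(t)‖²G(t)`.  Since `∫ dt/(−t)` diverges at the apex, on the window `[−½, −½e^{−N}]`, `N = (M+1)/η`, some `t̄` has
`(−t̄)²H(t̄) ≤ η` (`exists_sq_mul_le_of_budget`); the floor `G(t̄,x) ≥ c₁(−t̄)^{−3/2}e^{−4R²/c₂}` on `B(2R√(−t̄))` turns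
`η = c₁e^{−4R²/c₂}θ²/4` into the slice bound (`setIntegral_curl_sq_le_of_sq_mul_le`).

WHAT THIS IS NOT: not a claim about Navier–Stokes regularity and not a Type-I Liouville theorem; the mechanism stub of the
conditional door crux K2⁺ (the pressure monotonicity is a hypothesis).  bears_on LADDER-NS N0, rung N0-LocalTubeDoorPressureProfile.
-/

noncomputable section

set_option linter.dupNamespace false -- the summit and its sub-problem share the name (CONVENTIONS §1)

namespace Summit.NavierStokesRegularity.NavierStokesRegularity.Theorems.LocalPressureProfileDoorMonotonePressureProfileRigiditySmallSlice

open MeasureTheory Set Function Filter Metric Topology intervalIntegral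
open scoped ENNReal NNReal InnerProductSpace RealInnerProductSpace
open Literature.Analysis Literature.Analysis.FluidPDE
open Summit.NavierStokesRegularity.NavierStokesRegularity.Theorems.PoloidalWindowDoorPoloidalWindowRigidityWindow
  (isTypeIAncientMild_of_class)
open Summit.NavierStokesRegularity.NavierStokesRegularity.Theorems.RellichScarScarRigidity
  (exists_isClassicalNSSolutionOn_Iio isClassicalNSSolutionOn_rieszPressure)
open Summit.NavierStokesRegularity.NavierStokesRegularity.Theorems.LocalPressureProfileDoorMonotonePressureProfileRigiditySmallSliceKernel
open Summit.NavierStokesRegularity.NavierStokesRegularity.Theorems.LocalPressureProfileDoorMonotonePressureProfileRigiditySmallSlicePairings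
open Summit.NavierStokesRegularity.NavierStokesRegularity.Theorems.LocalPressureProfileDoorMonotonePressureProfileRigiditySmallSliceBudget

/-! ### The logarithmic divergence: a budget forces a small weighted slice near the apex -/

/-- `∫_{t₁}^{t₂} dt/(−t) = log((−t₁)/(−t₂))` for `t₁ ≤ t₂ < 0`. [folklore] -/
theorem integral_inv_neg {t₁ t₂ : ℝ} (h₁₂ : t₁ ≤ t₂) (h₂ : t₂ < 0) :
    ∫ t in t₁..t₂, (-t)⁻¹ = Real.log ((-t₁) / (-t₂)) := by
  rw [intervalIntegral.integral_comp_neg (f := fun u : ℝ => u⁻¹)]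
  rw [integral_inv (by
    rw [uIcc_of_le (by linarith)]
    exact fun h => by linarith [h.1])]

/-- **A budget on `(−t)H` forces `(−t̄)²H(t̄) ≤ η` somewhere near the apex.**  If `H ≥ 0`… more precisely: if for all windows
`−1 < t₁ ≤ t₂ < 0` the function `(−t)H(t)` is integrable with `∫_{t₁}^{t₂} (−t)H ≤ M`, then for every `η > 0` there is `t̄ ∈ [−½, 0)`
with `(−t̄)² H(t̄) ≤ η` — otherwise `(−t)H > η/(−t)` on `[−½, −½e^{−N}]`, `N = (M+1)/η`, whose integral is `ηN = M + 1`. [folklore] -/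
theorem exists_sq_mul_le_of_budget {H : ℝ → ℝ} {M : ℝ}
    (hM : ∀ t₁ t₂ : ℝ, -1 < t₁ → t₁ ≤ t₂ → t₂ < 0 →
      IntervalIntegrable (fun t => (-t) * H t) volume t₁ t₂ ∧ ∫ t in t₁..t₂, (-t) * H t ≤ M)
    {η : ℝ} (hη : 0 < η) :
    ∃ tb : ℝ, -1 < tb ∧ tb < 0 ∧ (-tb) ^ 2 * H tb ≤ η := by
  have hM0 : 0 ≤ M := by
    have h := (hM (-1 / 2) (-1 / 2) (by norm_num) le_rfl (by norm_num)).2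
    rwa [intervalIntegral.integral_same] at h
  set N : ℝ := (M + 1) / η with hN
  have hN0 : 0 < N := by rw [hN]; positivity
  set t₁ : ℝ := -1 / 2 with ht₁
  set t₂ : ℝ := -1 / 2 * Real.exp (-N) with ht₂
  have hexp : Real.exp (-N) < 1 := Real.exp_lt_one_iff.2 (by linarith)
  have hexp0 : 0 < Real.exp (-N) := Real.exp_pos _
  have h₁ : -1 < t₁ := by rw [ht₁]; norm_num
  have h₁₂ : t₁ ≤ t₂ := by rw [ht₁, ht₂]; nlinarith
  have h₂ : t₂ < 0 := by rw [ht₂]; nlinarith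
  by_contra hcon
  simp only [not_exists, not_and, not_le] at hcon
  -- on the window, `η/(−t) < (−t) H`
  have hlow : ∀ t ∈ Icc t₁ t₂, η * (-t)⁻¹ ≤ (-t) * H t := by
    intro t ht
    have ht0 : 0 < -t := by linarith [ht.2]
    have h := hcon t (by linarith [ht.1]) (by linarith [ht.2])
    rw [← div_eq_mul_inv, div_le_iff₀ ht0]
    nlinarith
  obtain ⟨hint, hle⟩ := hM t₁ t₂ h₁ h₁₂ h₂
  have hcont : ContinuousOn (fun t : ℝ => η * (-t)⁻¹) (Icc t₁ t₂) := by
    refine continuousOn_const.mul ((continuousOn_id.neg).inv₀ fun t ht => ?_)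
    have : t ≤ t₂ := ht.2
    exact ne_of_gt (by show (0 : ℝ) < -id t; simp only [id]; linarith)
  have hmono := intervalIntegral.integral_mono_on h₁₂ (hcont.intervalIntegrable_of_Icc h₁₂) hint hlow
  have hval : ∫ t in t₁..t₂, η * (-t)⁻¹ = M + 1 := by
    rw [intervalIntegral.integral_const_mul, integral_inv_neg h₁₂ h₂, ht₁, ht₂]
    have e : -(-1 / 2 : ℝ) / -(-1 / 2 * Real.exp (-N)) = Real.exp N := by
      rw [Real.exp_neg]; field_simp
    have hηne : η ≠ 0 := hη.ne'
    rw [e, Real.log_exp, hN]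
    field_simp
  have hbad : M + 1 ≤ M := by rw [← hval]; exact hmono.trans hle
  linarith

/-! ### From a small weighted slice to a small (9.17)-slice -/

/-- `s^{−3/2} · s² = √s` for `s > 0`. [folklore] -/
theorem rpow_neg_three_halves_mul_sq {s : ℝ} (hs : 0 < s) : s ^ (-(3 : ℝ) / 2) * s ^ 2 = Real.sqrt s := by
  rw [Real.sqrt_eq_rpow, show (s ^ 2 : ℝ) = s ^ (2 : ℝ) by norm_cast, ← Real.rpow_add hs]
  norm_num

/-- **The floor turns a small weighted slice into a small (9.17)-slice.**  If `G(t̄,x) ≥ c₁(−t̄)^{−3/2}e^{−‖x‖²/(c₂(−t̄))}`, the slice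
`v(t̄)` has square-integrable-on-balls continuous curl with `x ↦ ‖curl v(t̄,x)‖² G(t̄,x)` integrable, and
`(−t̄)² ∫ ‖curl v(t̄)‖² G(t̄) ≤ c₁ e^{−4R²/c₂} θ²/4`, then `∫_{B(2R√(−t̄))} ‖curl v(t̄)‖² ≤ θ²/(4√(−t̄))`. [folklore] -/
theorem setIntegral_curl_sq_le_of_sq_mul_le {G : ℝ → EuclideanSpace ℝ (Fin 3) → ℝ}
    {v : ℝ → EuclideanSpace ℝ (Fin 3) → EuclideanSpace ℝ (Fin 3)} {c₁ c₂ R θ tb : ℝ} (hc₁ : 0 < c₁) (hc₂ : 0 < c₂)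
    (hlow : ∀ t ∈ Ico (-1 : ℝ) 0, ∀ x : EuclideanSpace ℝ (Fin 3),
      c₁ * (-t) ^ (-(3 : ℝ) / 2) * Real.exp (-(‖x‖ ^ 2) / (c₂ * (-t))) ≤ G t x)
    (htb : tb ∈ Ico (-1 : ℝ) 0)
    (hfi : IntegrableOn (fun x => ‖curl (v tb) x‖ ^ 2) (ball 0 (2 * R * Real.sqrt (-tb))))
    (hfG : Integrable fun x => ‖curl (v tb) x‖ ^ 2 * G tb x)
    (hsmall : (-tb) ^ 2 * ∫ x, ‖curl (v tb) x‖ ^ 2 * G tb x ≤ c₁ * Real.exp (-(4 * R ^ 2) / c₂) * θ ^ 2 / 4) :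
    ∫ x in ball (0 : EuclideanSpace ℝ (Fin 3)) (2 * R * Real.sqrt (-tb)), ‖curl (v tb) x‖ ^ 2 ≤
      θ ^ 2 / (4 * Real.sqrt (-tb)) := by
  have hs : 0 < -tb := by linarith [htb.2]
  have hsq : 0 < Real.sqrt (-tb) := Real.sqrt_pos.2 hs
  set I : ℝ := ∫ x in ball (0 : EuclideanSpace ℝ (Fin 3)) (2 * R * Real.sqrt (-tb)), ‖curl (v tb) x‖ ^ 2 with hI
  have hfloor := setIntegral_ball_le_of_pairing hc₁.le hc₂ hlow htb (ρ := 2 * R * Real.sqrt (-tb))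
    (f := fun x => ‖curl (v tb) x‖ ^ 2) (fun x => sq_nonneg _) hfi hfG
  have hsne : (-tb) ≠ 0 := hs.ne'
  have hc₂ne : c₂ ≠ 0 := hc₂.ne'
  have hρ : -((2 * R * Real.sqrt (-tb)) ^ 2) / (c₂ * (-tb)) = -(4 * R ^ 2) / c₂ := by
    have e1 : (2 * R * Real.sqrt (-tb)) ^ 2 = 4 * R ^ 2 * (-tb) := by
      rw [mul_pow, mul_pow, Real.sq_sqrt hs.le]; ring
    rw [e1, div_eq_div_iff (by positivity) hc₂ne]
    ring
  rw [hρ] at hfloor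
  -- multiply the floor inequality by `(−t̄)²` and compare with `hsmall`
  set E : ℝ := c₁ * Real.exp (-(4 * R ^ 2) / c₂) with hE
  have hE0 : 0 < E := by rw [hE]; positivity
  have h1 : E * (Real.sqrt (-tb) * I) ≤ E * (θ ^ 2 / 4) := by
    have h2 : (-tb) ^ 2 * (c₁ * (-tb) ^ (-(3 : ℝ) / 2) * Real.exp (-(4 * R ^ 2) / c₂) * I) ≤
        (-tb) ^ 2 * ∫ x, ‖curl (v tb) x‖ ^ 2 * G tb x := mul_le_mul_of_nonneg_left hfloor (sq_nonneg _)
    have e : (-tb) ^ 2 * (c₁ * (-tb) ^ (-(3 : ℝ) / 2) * Real.exp (-(4 * R ^ 2) / c₂) * I) =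
        E * (Real.sqrt (-tb) * I) := by
      rw [hE, ← rpow_neg_three_halves_mul_sq hs]; ring
    rw [e] at h2
    exact h2.trans (hsmall.trans_eq (by rw [hE]; ring))
  have h3 : Real.sqrt (-tb) * I ≤ θ ^ 2 / 4 := le_of_mul_le_mul_left h1 hE0
  rw [le_div_iff₀ (by positivity)]
  linarith

/-! ### The registered stub -/

/-- **STUB `stub_smallSliceOfMonotonePressure` of line `birth` (crux K2⁺ `MonotonePressureProfileRigidity`,
stmt-NavierStokesRegularity-20180; signature verbatim).**  A door-class profile (Type I in time, space–time Type-I decay, continuous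
on the open backward slab, unit-viscosity Oseen–Duhamel mild, divergence-free slices) whose similarity Riesz pressure is
shift-monotone has, for every `R, θ > 0`, a slice `t̄ < 0` with `∫_{B(2R√(−t̄))} ‖curl v(t̄)‖² ≤ θ²/(4√(−t̄))`.  Proof: the class
membership (`isTypeIAncientMild_of_class` — THE OSEEN–DUHAMEL IDENTITY IS CONSUMED HERE), the adapted backward kernel at the apex
(`exists_apexKernel`), the dissipation budget (`dissipation_budget`), the logarithmic divergence (`exists_sq_mul_le_of_budget`) and
the kernel floor (`setIntegral_curl_sq_le_of_sq_mul_le`). [cite: Tsai1998, §5; PineauVicol2026, (9.17), arXiv:2607.09619 p. 33] -/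
theorem stub_smallSliceOfMonotonePressure :
    ∀ (C D : ℝ) (v : ℝ → EuclideanSpace ℝ (Fin 3) → EuclideanSpace ℝ (Fin 3)),
    Literature.Analysis.FluidPDE.HasTypeITimeDecay C v →
    Literature.Analysis.FluidPDE.HasTypeIDecay D v →
    ContinuousOn (Function.uncurry v) (Set.Iio (0 : ℝ) ×ˢ Set.univ) →
    (∀ s t : ℝ, s < t → t < 0 → ∀ x, v t x =
      Literature.Analysis.UnboundedOperators.heatExtension (v s) (t - s) x -
        Literature.Analysis.FluidPDE.oseenDuhamel 1 s v v t x) →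
    (∀ t < 0, Literature.Analysis.FluidPDE.VectorCalculus.IsDivFree (v t)) →
    (∀ t < 0, ∀ σ ∈ Set.Icc (0 : ℝ) 1, ∀ y : EuclideanSpace ℝ (Fin 3),
      (-(Real.exp (-σ) * t)) * Literature.Analysis.FluidPDE.pressurePotential (v (Real.exp (-σ) * t))
          (Real.sqrt (-(Real.exp (-σ) * t)) • y) ≤
        (-t) * Literature.Analysis.FluidPDE.pressurePotential (v t) (Real.sqrt (-t) • y)) →
    ∀ R θ : ℝ, 0 < R → 0 < θ → ∃ tb : ℝ, tb < 0 ∧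
      (∫⁻ x in Metric.ball (0 : EuclideanSpace ℝ (Fin 3)) (2 * R * Real.sqrt (-tb)),
          ENNReal.ofReal (‖Literature.Analysis.FluidPDE.curl (v tb) x‖ ^ 2)) ≤
        ENNReal.ofReal (θ ^ 2 / (4 * Real.sqrt (-tb))) := by
  intro C D v _hrate hdecay hcont hmild hdiv hmono R θ hR hθ
  have hD0 : 0 ≤ D := nonneg_of_hasTypeIDecay hdecay
  -- the class membership at the space–time constant `D` (the Oseen–Duhamel identity is used here)
  have hA : IsTypeIAncientMild D v := isTypeIAncientMild_of_class (hdecay.hasTypeITimeDecay hD0) hcont hmild hdiv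
  -- the Riesz pressure is classical, and the class bounds
  obtain ⟨q, hq⟩ := exists_isClassicalNSSolutionOn_Iio hA
  have hcl : IsClassicalNSSolutionOn (Iio (0 : ℝ)) 1 0 v (fun t x => pressurePotential (v t) x) :=
    isClassicalNSSolutionOn_rieszPressure hq hdecay
  obtain ⟨L, hL0, h1, -, -⟩ := apex_bounds hA hdecay hcl
  -- the adapted backward kernel at the apex
  obtain ⟨G, c₁, c₂, C₁, C₂, hc₁, hc₂, hC₁, hC₂, hK, hlow, hup⟩ := exists_apexKernel hA
  -- the budget
  obtain ⟨M, hM⟩ := dissipation_budget hA hdecay hmono hK hC₁.le hC₂ hup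
  -- a small weighted slice near the apex
  set η : ℝ := c₁ * Real.exp (-(4 * R ^ 2) / c₂) * θ ^ 2 / 4 with hη
  have hη0 : 0 < η := by rw [hη]; positivity
  obtain ⟨tb, htb1, htb0, hsmall⟩ := exists_sq_mul_le_of_budget hM hη0
  have htbK : tb ∈ Ico (-1 : ℝ) 0 := ⟨htb1.le, htb0⟩
  have hs : 0 < -tb := by linarith
  refine ⟨tb, htb0, ?_⟩
  -- integrability of the slice integrands
  have hcurl : Continuous fun x => ‖curl (v tb) x‖ ^ 2 := by
    have hc2 : ContDiff ℝ 2 (v tb) := (hcl.contDiff_velocity htb0).of_le (by norm_cast)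
    have hD : Continuous fun x => fderiv ℝ (v tb) x := hc2.continuous_fderiv (by norm_num)
    have e : (fun x => curl (v tb) x) = fun x => curlCLM (fderiv ℝ (v tb) x) := funext fun x => curl_eq_curlCLM _ _
    have hc : Continuous fun x => curl (v tb) x := by rw [e]; exact curlCLM.continuous.comp hD
    exact (hc.norm).pow 2
  have hbdd : ∀ x, |‖curl (v tb) x‖ ^ 2| ≤ (4 * (L / (-tb))) ^ 2 := by
    intro x
    rw [abs_of_nonneg (sq_nonneg _)]
    have hDv : ‖fderiv ℝ (v tb) x‖ ≤ L / (-tb) := by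
      refine (h1 tb htb0 x).trans (div_le_div_of_nonneg_left hL0 hs ?_)
      calc -tb = Real.sqrt (-tb) ^ 2 := (Real.sq_sqrt hs.le).symm
        _ ≤ (‖x‖ + Real.sqrt (-tb)) ^ 2 :=
            pow_le_pow_left₀ (Real.sqrt_nonneg _) (by linarith [norm_nonneg x]) 2
    have h4 : ‖curl (v tb) x‖ ≤ 4 * (L / (-tb)) := (norm_curl_le_four_mul (v tb) x).trans (by linarith)
    exact pow_le_pow_left₀ (norm_nonneg _) h4 2
  have hfG : Integrable fun x => ‖curl (v tb) x‖ ^ 2 * G tb x :=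
    integrable_mul_kernel hcurl hbdd (hK.integrable htbK) (hK.contDiff_slice htbK).continuous
  have hfi : IntegrableOn (fun x => ‖curl (v tb) x‖ ^ 2) (ball (0 : EuclideanSpace ℝ (Fin 3)) (2 * R * Real.sqrt (-tb))) :=
    (hcurl.continuousOn.integrableOn_compact
      (isCompact_closedBall (0 : EuclideanSpace ℝ (Fin 3)) (2 * R * Real.sqrt (-tb)))).mono_set ball_subset_closedBall
  -- the (9.17)-slice bound, as a real integral
  have hreal := setIntegral_curl_sq_le_of_sq_mul_le hc₁ hc₂ hlow htbK hfi hfG (by rw [hη] at hsmall; exact hsmall)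
  -- as a lintegral
  have hnn : 0 ≤ᵐ[volume.restrict (ball (0 : EuclideanSpace ℝ (Fin 3)) (2 * R * Real.sqrt (-tb)))]
      fun x => ‖curl (v tb) x‖ ^ 2 := Eventually.of_forall fun x => sq_nonneg _
  rw [← ofReal_integral_eq_lintegral_ofReal hfi hnn]
  exact ENNReal.ofReal_le_ofReal hreal

end Summit.NavierStokesRegularity.NavierStokesRegularity.Theorems.LocalPressureProfileDoorMonotonePressureProfileRigiditySmallSlice

end
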